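import Summits.QuantumFields.YangMills.Theorems.WeakCouplingRatesDirichletVsFree
import Summits.QuantumFields.YangMills.Theorems.WeakCouplingRatesBulkDominatesColdBoxWDefs

/-!
# Crux `BulkDominatesColdBoxW` (stmt-QuantumFields-19609), stub L1b `stub_goodBoundaryMeanSmooth`: interface N1′
# `DirKernelDiagFlat` — the temporal-gauge Dirichlet projection kernel is the `ℤ⁴` curl kernel up to `O(H⁻⁴)` at ANY
# two plaquettes near the centre, hence its diagonal is flat there

Route `WeakCouplingRates` (rev 2), line `dlr-chessboard` (skeleton v4 `355a68b80645dd42`), fleet seat `ym-spine-20043-p1` (g3,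
re-targeted to R2ξ by director-ym LINE №76/№78; line lead `ym-wcr-19609-p1`).  The lead's census v3 (item evidence #12) splits
L1b into the two typed interfaces `KernelMeanExpansion` and `DirKernelDiagFlat` of
`Theorems/WeakCouplingRatesBulkDominatesColdBoxWDefs.lean`; this file PROVES the second BY NAME:

* `exists_boxDirProjKernel_sub_curl_bound` — **the Dirichlet twin of `exists_boxProjKernel_sub_curl_bound` in full two-plaquette
  form**: there is `K` with `|boxDirProjKernel H p q − (d₁ div₂ g_q)(p)| ≤ K/H⁴` for every `H ≥ 32` and all plaquettes `p, q`
  (`i < j`) based within sup-distance `H/8` of the centre.  The proof is the one of `exists_boxDirichletPlaqCov_sub_bound`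
  (`Theorems/WeakCouplingRatesDirichletVsFree.lean`, seat `ym-wcr-19608-p2`: projection onto cold-box curls, point mass split with
  potential and co-potential cut off by the ramp `boxCutoff H`, `abs_dirKernel_sub_curl_le`), run at a general pair instead of the
  central pair `(p_c, p_c + Te₀)`;
* `curl_greenTensor_self` — the coincident value `(d₁ div₂ g_q)(q)` does not depend on the base point (translation invariance,
  `curl_greenTensor_shift`);
* `abs_boxDirProjKernel_diag_sub_le` — hence `|V_D(x;i,j) − V_D(x';i,j)| ≤ 2K/H⁴` for `x, x'` within `H/8` of the centre;
* `dirKernelDiagFlat : DirKernelDiagFlat` — the typed interface (rate `K/H`, integer form of «within `H/8`», planes `(1,2)`), closed.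

No sorry, standard axioms, no new definition, no named-fact hypothesis.  NOT a claim about the mass gap: a statement about a
finite-dimensional Gaussian kernel.
-/

set_option autoImplicit false

noncomputable section

open Finset Matrix Real
open Literature.Probability.LatticeModels
open Literature.MathematicalPhysics.QuantumLattice
open Literature.MathematicalPhysics.QuantumFieldTheory
open Literature.MathematicalPhysics.QuantumFieldTheory.LatticeMaxwell
open Literature.MathematicalPhysics.QuantumFieldTheory.AxialGauge
open Literature.MathematicalPhysics.QuantumFieldTheory.LatticeChain
open Literature.MathematicalPhysics.QuantumFieldTheory.LatticeForm (e d₀ d₁ d₂)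

namespace Summit.QuantumFields.YangMills.Theorems.WeakCouplingRates

/-! ## Plaquettes near the centre as labels of the enlarged box -/

/-- A plaquette `p = (x; i<j)` based within sup-distance `H/8` of the centre is (the `dirCorner`-translate of) a plaquette
label of the enlarged box `{0,…,2H+2}⁴`. -/
theorem near_centre_label_mem {H : ℕ} {p : Plaq 4} (hx : ‖p.1 - boxCentre H‖ ≤ (H : ℝ) / 8) (hij : p.2.1 < p.2.2) :
    ((p.1 - dirCorner, p.2) : Plaq 4) ∈ plaquettesIn (halfOpenBox 4 (2 * H + 3)) ∧
      Plaq.shift dirCorner ((p.1 - dirCorner, p.2) : Plaq 4) = p := by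
  obtain ⟨x, i, j⟩ := p
  simp only at hx hij
  have hcoord : ∀ m : Fin 4, |((x m : ℤ) : ℝ) - H| ≤ (H : ℝ) / 8 := by
    intro m
    have h1 : ‖(x - boxCentre H) m‖ ≤ ‖x - boxCentre H‖ := norm_le_pi_norm _ m
    have h2 : ‖(x - boxCentre H) m‖ = |((x m : ℤ) : ℝ) - H| := by
      simp only [Pi.sub_apply, boxCentre, Int.norm_eq_abs, Int.cast_sub, Int.cast_natCast]
    rw [h2] at h1
    exact h1.trans hx
  have hmem : ∀ v : Site 4, (∀ m, 0 ≤ v m ∧ v m ≤ 1) → x - dirCorner + v ∈ halfOpenBox 4 (2 * H + 3) := by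
    intro v hv
    rw [mem_halfOpenBox]
    intro m
    have h1 := hcoord m
    have h2 := hv m
    have h3 : (0 : ℝ) ≤ H := Nat.cast_nonneg H
    have hlo : -((H : ℝ) / 8) ≤ ((x m : ℤ) : ℝ) - H := (abs_le.1 h1).1
    have hhi : ((x m : ℤ) : ℝ) - H ≤ (H : ℝ) / 8 := (abs_le.1 h1).2
    have hlo' : (0 : ℝ) ≤ ((x m : ℤ) : ℝ) := by linarith
    have hhi' : ((x m : ℤ) : ℝ) ≤ 2 * (H : ℝ) := by linarith
    have hlo'' : (0 : ℤ) ≤ x m := by exact_mod_cast hlo'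
    have hhi'' : x m ≤ 2 * (H : ℤ) := by exact_mod_cast hhi'
    simp only [Pi.add_apply, Pi.sub_apply, dirCorner]
    push_cast
    constructor <;> omega
  have b0 : ∀ m : Fin 4, 0 ≤ (0 : Site 4) m ∧ (0 : Site 4) m ≤ 1 := fun m => by simp
  have b1 : ∀ (k : Fin 4) (m : Fin 4), 0 ≤ (Pi.single k (1 : ℤ) : Site 4) m ∧ (Pi.single k (1 : ℤ) : Site 4) m ≤ 1 := by
    intro k m; simp only [Pi.single_apply]; split_ifs <;> omega
  have b2 : ∀ m : Fin 4, 0 ≤ (Pi.single i (1 : ℤ) + Pi.single j 1 : Site 4) m ∧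
      (Pi.single i (1 : ℤ) + Pi.single j 1 : Site 4) m ≤ 1 := by
    intro m
    have hij' : i ≠ j := ne_of_lt hij
    simp only [Pi.add_apply, Pi.single_apply]
    by_cases h1 : m = i
    · subst h1; simp [hij']
    · by_cases h2 : m = j
      · subst h2; simp [h1]
      · simp [h1, h2]
  have hc : x - dirCorner ∈ halfOpenBox 4 (2 * H + 3) := by simpa using hmem 0 b0
  refine ⟨Plaq.mem_plaquettesIn.2 ⟨hc, hij, hmem _ (b1 i), hmem _ (b1 j), ?_⟩, ?_⟩
  · rw [add_assoc]; exact hmem _ b2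
  · simp only [Plaq.shift, sub_add_cancel]

/-! ## The Dirichlet kernel is the `ℤ⁴` kernel up to `O(H⁻⁴)`, at any two plaquettes near the centre -/

/-- **The temporal-gauge Dirichlet projection kernel is the `ℤ⁴` curl kernel up to `O(H⁻⁴)`** (Dirichlet twin of
`exists_boxProjKernel_sub_curl_bound`, general pair): there is `K` such that for every `H ≥ 32` and all plaquettes `p = (x;i<j)`,
`q = (x';i'<j')` based within sup-distance `H/8` of the centre, `|boxDirProjKernel H p q − (d₁ div₂ g_q)(p)| ≤ K/H⁴`. -/
theorem exists_boxDirProjKernel_sub_curl_bound : ∃ K : ℝ, 0 ≤ K ∧ ∀ (H : ℕ), (32 : ℝ) ≤ H →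
    ∀ (p q : Plaq 4), p.2.1 < p.2.2 → q.2.1 < q.2.2 →
      ‖p.1 - boxCentre H‖ ≤ (H : ℝ) / 8 → ‖q.1 - boxCentre H‖ ≤ (H : ℝ) / 8 →
      |boxDirProjKernel H p q - d₁ (div₂ (greenTensor q)) p.1 p.2.1 p.2.2| ≤ K / (H : ℝ) ^ 4 := by
  obtain ⟨K_Z, hKZ0, hKZ⟩ := exists_curl_greenTensor_bound
  obtain ⟨K_W, hKW0, hKW⟩ := exists_d₂_greenTensor_bound
  obtain ⟨K_φ, hKφ0, hKφ⟩ := exists_div₂_greenTensor_bound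
  set K_A : ℝ := 256 * K_Z + 256 * K_φ with hKA
  set K_V : ℝ := 256 * K_φ + 512 * K_W with hKV
  have hKA0 : 0 ≤ K_A := by positivity
  have hKV0 : 0 ≤ K_V := by positivity
  refine ⟨1296 * (K_A * K_V + K_V ^ 2), by positivity, fun H hH p q hpij hqij hpc hqc => ?_⟩
  have hH0 : (0 : ℝ) < H := by linarith
  have hHn : 0 < H := by exact_mod_cast hH0
  have hH3 : 3 ≤ H := by
    have : (3 : ℝ) ≤ H := by linarith
    exact_mod_cast this
  obtain ⟨hp, hps⟩ := near_centre_label_mem hpc hpij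
  obtain ⟨hq, hqs⟩ := near_centre_label_mem hqc hqij
  set P := plaquettesIn (halfOpenBox 4 (2 * H + 3)) with hP
  have hmain := abs_dirKernel_sub_curl_le H hp hq (χ := boxCutoff H) (fun y hy => mem_halfOpenBox_of_boxCutoff_ne_zero y hy)
  rw [hps, hqs] at hmain
  have hker : boxDirProjKernel H p q =
      coeff (fun e => e ∉ dirFreeEdges H) dirCorner (2 * H + 3) p ⬝ᵥ
        (Qmat (fun e => e ∉ dirFreeEdges H) dirCorner (2 * H + 3))⁻¹ *ᵥ
          coeff (fun e => e ∉ dirFreeEdges H) dirCorner (2 * H + 3) q := rfl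
  rw [← hker] at hmain
  -- the main term: `p` lies on the plateau, so the cut-off is invisible there
  have hplat : ‖p.1 - boxCentre H‖ ≤ (H : ℝ) / 2 - 2 := by linarith
  rw [d₁_cutoff_eq_of_plateau hHn _ hplat] at hmain
  -- pointwise bounds
  have hKAH : 0 ≤ K_A / (H : ℝ) ^ 4 := div_nonneg hKA0 (pow_nonneg hH0.le 4)
  have hKVH : 0 ≤ K_V / (H : ℝ) ^ 4 := div_nonneg hKV0 (pow_nonneg hH0.le 4)
  have hV : ∀ (z : Plaq 4), ‖z.1 - boxCentre H‖ ≤ (H : ℝ) / 8 → ∀ y : Site 4, ∀ k l : Fin 4,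
      |d₁ (fun x'' a => (1 - boxCutoff H x'') * div₂ (greenTensor z) x'' a) y k l +
          div₃ (fun y a b c => (1 - boxCutoff H y) * d₂ (greenTensor z) y a b c) y k l| ≤ K_V / (H : ℝ) ^ 4 := by
    intro z hz y k l
    by_cases hfar : (H : ℝ) / 2 - 2 < ‖y - boxCentre H‖
    · exact abs_dirRemainder_le hKφ0 hKW0 hKφ hKW hH hz hfar k l
    · rw [dirRemainder_eq_zero_of_plateau hHn z (not_lt.1 hfar), abs_zero]; exact hKVH
  have hAV : ∀ p' ∈ P,
      |d₁ (fun y a => boxCutoff H y * div₂ (greenTensor p) y a)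
          (Plaq.shift dirCorner p').1 (Plaq.shift dirCorner p').2.1 (Plaq.shift dirCorner p').2.2| *
        |d₁ (fun y a => (1 - boxCutoff H y) * div₂ (greenTensor q) y a)
            (Plaq.shift dirCorner p').1 (Plaq.shift dirCorner p').2.1 (Plaq.shift dirCorner p').2.2 +
          div₃ (fun y a b c => (1 - boxCutoff H y) * d₂ (greenTensor q) y a b c)
            (Plaq.shift dirCorner p').1 (Plaq.shift dirCorner p').2.1 (Plaq.shift dirCorner p').2.2| ≤
        (K_A / (H : ℝ) ^ 4) * (K_V / (H : ℝ) ^ 4) := by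
    intro p' _
    by_cases hfar : (H : ℝ) / 2 - 2 < ‖(Plaq.shift dirCorner p').1 - boxCentre H‖
    · exact mul_le_mul (abs_d₁_cutoff_le hKZ0 hKφ0 hKZ hKφ hH hpc hfar _ _) (hV _ hqc _ _ _) (abs_nonneg _) hKAH
    · rw [dirRemainder_eq_zero_of_plateau hHn _ (not_lt.1 hfar), abs_zero, mul_zero]; exact mul_nonneg hKAH hKVH
  have hcard := card_enlargedPlaquettes_le hH3
  have hnsmul : (#P • ((K_A / (H : ℝ) ^ 4) * (K_V / (H : ℝ) ^ 4)) : ℝ) ≤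
      1296 * (H : ℝ) ^ 4 * ((K_A / (H : ℝ) ^ 4) * (K_V / (H : ℝ) ^ 4)) := by
    rw [nsmul_eq_mul]; exact mul_le_mul_of_nonneg_right hcard (mul_nonneg hKAH hKVH)
  have hsum1 := (Finset.sum_le_card_nsmul _ _ _ hAV).trans hnsmul
  have hsq : ∀ (z : Plaq 4), ‖z.1 - boxCentre H‖ ≤ (H : ℝ) / 8 →
      ∑ p' ∈ P, (d₁ (fun x'' a => (1 - boxCutoff H x'') * div₂ (greenTensor z) x'' a)
            (Plaq.shift dirCorner p').1 (Plaq.shift dirCorner p').2.1 (Plaq.shift dirCorner p').2.2 +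
          div₃ (fun y a b c => (1 - boxCutoff H y) * d₂ (greenTensor z) y a b c)
            (Plaq.shift dirCorner p').1 (Plaq.shift dirCorner p').2.1 (Plaq.shift dirCorner p').2.2) ^ 2 ≤
        1296 * (H : ℝ) ^ 4 * (K_V / (H : ℝ) ^ 4) ^ 2 := by
    intro z hz
    have hterm : ∀ p' ∈ P, (d₁ (fun x'' a => (1 - boxCutoff H x'') * div₂ (greenTensor z) x'' a)
            (Plaq.shift dirCorner p').1 (Plaq.shift dirCorner p').2.1 (Plaq.shift dirCorner p').2.2 +
          div₃ (fun y a b c => (1 - boxCutoff H y) * d₂ (greenTensor z) y a b c)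
            (Plaq.shift dirCorner p').1 (Plaq.shift dirCorner p').2.1 (Plaq.shift dirCorner p').2.2) ^ 2 ≤
          (K_V / (H : ℝ) ^ 4) ^ 2 := by
      intro p' _
      rw [← sq_abs]
      exact pow_le_pow_left₀ (abs_nonneg _) (hV z hz _ _ _) 2
    refine (Finset.sum_le_card_nsmul _ _ _ hterm).trans ?_
    rw [nsmul_eq_mul]
    exact mul_le_mul_of_nonneg_right hcard (pow_nonneg hKVH 2)
  set B := 1296 * (H : ℝ) ^ 4 * (K_V / (H : ℝ) ^ 4) ^ 2 with hB
  have hB0 : 0 ≤ B := mul_nonneg (by positivity) (pow_nonneg hKVH 2)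
  have hsum2 : Real.sqrt (∑ p' ∈ P, (d₁ (fun x'' a => (1 - boxCutoff H x'') * div₂ (greenTensor p) x'' a)
            (Plaq.shift dirCorner p').1 (Plaq.shift dirCorner p').2.1 (Plaq.shift dirCorner p').2.2 +
          div₃ (fun y a b c => (1 - boxCutoff H y) * d₂ (greenTensor p) y a b c)
            (Plaq.shift dirCorner p').1 (Plaq.shift dirCorner p').2.1 (Plaq.shift dirCorner p').2.2) ^ 2) *
      Real.sqrt (∑ p' ∈ P, (d₁ (fun x'' a => (1 - boxCutoff H x'') * div₂ (greenTensor q) x'' a)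
            (Plaq.shift dirCorner p').1 (Plaq.shift dirCorner p').2.1 (Plaq.shift dirCorner p').2.2 +
          div₃ (fun y a b c => (1 - boxCutoff H y) * d₂ (greenTensor q) y a b c)
            (Plaq.shift dirCorner p').1 (Plaq.shift dirCorner p').2.1 (Plaq.shift dirCorner p').2.2) ^ 2) ≤ B := by
    calc _ ≤ Real.sqrt B * Real.sqrt B :=
          mul_le_mul (Real.sqrt_le_sqrt (hsq _ hpc)) (Real.sqrt_le_sqrt (hsq _ hqc)) (Real.sqrt_nonneg _) (Real.sqrt_nonneg _)
      _ = B := Real.mul_self_sqrt hB0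
  refine hmain.trans ((add_le_add hsum1 hsum2).trans (le_of_eq ?_))
  rw [hB]
  field_simp

/-! ## The diagonal of the Dirichlet kernel is flat near the centre -/

/-- The coincident value of the `ℤ⁴` curl kernel does not depend on the base point: `(d₁ div₂ g_{(x;i,j)})(x;i,j) =
(d₁ div₂ g_{(0;i,j)})(0;i,j)` (translation invariance). -/
theorem curl_greenTensor_self (x : Site 4) (i j : Fin 4) :
    d₁ (div₂ (greenTensor ((x, i, j) : Plaq 4))) x i j = d₁ (div₂ (greenTensor ((0, i, j) : Plaq 4))) 0 i j := by
  have h := curl_greenTensor_shift (0 : Site 4) 0 x i j i j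
  simpa only [zero_add] using h

/-- **The diagonal of the Dirichlet kernel is flat near the centre, rate `H⁻⁴`**: with the constant `K` of
`exists_boxDirProjKernel_sub_curl_bound`, for `H ≥ 32` and base points `x, x'` within sup-distance `H/8` of the centre,
`|V_D(x;i,j) − V_D(x';i,j)| ≤ 2K/H⁴` (`i < j`). -/
theorem abs_boxDirProjKernel_diag_sub_le : ∃ K : ℝ, 0 ≤ K ∧ ∀ (H : ℕ), (32 : ℝ) ≤ H →
    ∀ (x x' : Site 4) (i j : Fin 4), i < j →
      ‖x - boxCentre H‖ ≤ (H : ℝ) / 8 → ‖x' - boxCentre H‖ ≤ (H : ℝ) / 8 →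
      |boxDirProjKernel H (x, i, j) (x, i, j) - boxDirProjKernel H (x', i, j) (x', i, j)| ≤ 2 * K / (H : ℝ) ^ 4 := by
  obtain ⟨K, hK0, hK⟩ := exists_boxDirProjKernel_sub_curl_bound
  refine ⟨K, hK0, fun H hH x x' i j hij hx hx' => ?_⟩
  have h1 := hK H hH (x, i, j) (x, i, j) hij hij hx hx
  have h2 := hK H hH (x', i, j) (x', i, j) hij hij hx' hx'
  simp only at h1 h2
  rw [curl_greenTensor_self x i j] at h1
  rw [curl_greenTensor_self x' i j] at h2
  rw [abs_sub_comm] at h2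
  have h3 := (abs_sub_le _ (d₁ (div₂ (greenTensor ((0, i, j) : Plaq 4))) 0 i j) _).trans (add_le_add h1 h2)
  refine h3.trans (le_of_eq ?_)
  ring

/-- From the integer form «`8|x_m − H| ≤ H` for every coordinate» to the sup-norm form `‖x − c‖ ≤ H/8`. -/
theorem norm_sub_boxCentre_le_of_int {H : ℕ} {x : Site 4} (hx : ∀ m : Fin 4, 8 * |x m - (H : ℤ)| ≤ (H : ℤ)) :
    ‖x - boxCentre H‖ ≤ (H : ℝ) / 8 := by
  refine (pi_norm_le_iff_of_nonneg (by positivity)).2 fun m => ?_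
  have h1 := hx m
  have h2 : (8 : ℝ) * |((x m : ℤ) : ℝ) - H| ≤ H := by
    have : ((8 * |x m - (H : ℤ)| : ℤ) : ℝ) ≤ ((H : ℤ) : ℝ) := by exact_mod_cast h1
    push_cast at this
    exact this
  have h3 : ‖(x - boxCentre H) m‖ = |((x m : ℤ) : ℝ) - H| := by
    simp only [Pi.sub_apply, boxCentre, Int.norm_eq_abs, Int.cast_sub, Int.cast_natCast]
  rw [h3]
  linarith

/-- **Interface N1′ of stub L1b, CLOSED: `DirKernelDiagFlat`** — there are `K`, `H₀` such that for `H ≥ H₀` and any two base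
points within `H/8` of the centre the Dirichlet variances of the `(1,2)`-circulations differ by at most `K/H` (in fact by
`O(H⁻⁴)`, `abs_boxDirProjKernel_diag_sub_le`). -/
theorem dirKernelDiagFlat : DirKernelDiagFlat := by
  obtain ⟨K, hK0, hK⟩ := abs_boxDirProjKernel_diag_sub_le
  refine ⟨2 * K, 32, fun H hH x x' hx hx' => ?_⟩
  have hHr : (32 : ℝ) ≤ H := by exact_mod_cast hH
  have hH1 : (1 : ℝ) ≤ H := by linarith
  have hH0 : (0 : ℝ) < H := by linarith
  have h := hK H hHr x x' 1 2 (by decide) (norm_sub_boxCentre_le_of_int hx) (norm_sub_boxCentre_le_of_int hx')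
  refine h.trans ?_
  rw [div_le_div_iff₀ (pow_pos hH0 4) hH0]
  have h4 : (H : ℝ) ≤ (H : ℝ) ^ 4 := by
    calc (H : ℝ) = (H : ℝ) ^ 1 := (pow_one _).symm
      _ ≤ (H : ℝ) ^ 4 := pow_le_pow_right₀ hH1 (by norm_num)
  have hK2 : 0 ≤ 2 * K := by positivity
  nlinarith

end Summit.QuantumFields.YangMills.Theorems.WeakCouplingRates

end
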